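/- Copyright: the b2b-balaban cell (near-miss cell 7), T⁴-continuum fan-out, lineage t4-ne7b-p1 (node U5c COUNT
member).  Released under the licence of the surrounding project. -/
import Literature.MathematicalPhysics.QuantumFieldTheory.Balaban1983to89.T4PersistentHistoryCount

/-!
# Multiset records: the paired record sum with MULTIPLICITIES (seed of the COUNT route's carrier debt F-ne7bp1g22-1(d))

Summits-side support leaf of the T⁴-continuum cell (rung (B)+1 on a FINITE torus only; NOT infinite volume, NOT the
mass gap, NOT the Clay statement; NOT a proof of the spine estimate NE7b).  Lineage `t4-ne7b-p1` (generation 22, row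
NE7b owner), node U5c.  [folklore] finite combinatorics and real analysis; nothing is quoted from print and nothing
printed is asserted; no `[cite:]` tag; no `def … : Prop` fact (one decidable arithmetic predicate).

WHY (GAPS F-ne7bp1g22-1(d)).  The landed records count (`T4PersistentHistoryCount` §1–§2) counts the records of a pending
structure as SUBSETS `Q ⊆ E` of the event universe — `Σ_{Q ⊆ E} ∏_{e ∈ Q} η e = ∏_{e ∈ E} (1 + η e) ≤ e^{Σ η}`
(`pairedRecordSum_le`, `prod_one_add_le_exp_sum`) — and the genealogy carrier stores events as a SET of type triples.
Print's admissible sequences need MULTISETS of types (two regions of one class born at one step inside one pending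
structure; several same-step joins).  THIS LEAF proves the counting identity the multiset re-typing will rest on: over
MULTIPLICITIES `m : E → {0, …, N}` (any cap `N`; bounds uniform in `N`),
`Σ_m ∏_{e ∈ E} (η e)^{m e} = ∏_{e ∈ E} Σ_{k ≤ N} (η e)^k ≤ ∏_{e ∈ E} (1 − η e)⁻¹ ≤ e^{2 Σ_{e ∈ E} η e}` for
`0 ≤ η ≤ ½` — so the count's two-rate shape survives with the per-step residual entropy DOUBLED (`η̄ ↦ 2η̄`, rate
`Λ·e^{2η̄ − κ₁}`), and the paired record sum under the span condition `K + 1 − j ≤ W b + Σ_e m e · W e` holds in the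
shape of `pairedRecordSum_le`.

WHAT.  §1 the geometric partial-sum inequality `geom_partial_le_inv`.  §2 the multiplicity count
`sum_prod_pow_eq`, `sum_prod_pow_le_prod_inv`, `prod_inv_one_sub_le_exp`.  §3 the span condition with multiplicities
`SpanLEM` (decidable), the paired factor `pairedFactorM_le`, and **`pairedRecordSumM_le`**: under the multiplicity price
hypothesis `y m ≤ ρ·e^{−κ₁W b}·∏_e (e^{−κ₁W e}·η e)^{m e}` on span-admissible `m` (`y ≤ 0` elsewhere),
`Σ_m y m ≤ ρ·e^{−κ₁(K+1−j)}·∏_{e ∈ E}(1 − η e)⁻¹`.  §4 per-step form **`slotPriceM_le`**: with the universe on the steps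
`(j, K]`, per-step residual entropy `≤ η̄` and `η ≤ ½`: `Σ_m y m ≤ ρ·e^{−κ₁}·(e^{2η̄ − κ₁})^{K − j}` — `slotPrice_le`'s shape
at the doubled rate.  §5 decided sanity.  NOT DONE HERE: the multiset genealogy carrier (per-occurrence placement) and
`slotDom_of_records`∕the banking over it — the route's next kernel items.

HONEST.  Counting over our own carrier; proves no estimate of Bałaban's.  NE7b NOT proved.  HONEST DEPENDENCY (cell):
continuum YM on T⁴ ⇐ BetaPertH ∧ nine spine estimates (0/9 proved); BetaPertH ⇐ (D1) ∧ (D4) ∧ CAP+tail.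
-/

open Finset
open Literature.MathematicalPhysics.QuantumFieldTheory.Balaban1983to89
open T4PersistentHistoryCount

namespace Summit.QuantumFields.BalabanUV.T4Continuum.MultisetRecords

noncomputable section

/-! ## §1 Two real inequalities -/

/-- geometric partial sums stay below the full sum: `Σ_{k ≤ N} x^k ≤ (1 − x)⁻¹` for `0 ≤ x < 1`. [folklore] -/
theorem geom_partial_le_inv {x : ℝ} (h0 : 0 ≤ x) (h1 : x < 1) (N : ℕ) :
    ∑ k ∈ range (N + 1), x ^ k ≤ (1 - x)⁻¹ := by
  have h := geom_sum_Ico_le_of_lt_one (m := 0) (n := N + 1) h0 h1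
  rwa [pow_zero, ← Finset.range_eq_Ico, one_div] at h

/- `(1 − x)⁻¹ ≤ e^{2x}` for `0 ≤ x ≤ ½` is already in the tree (`Literature.NumberTheory.Automorphic.MeanSquareSchurGL2`,
an unrelated import closure); it is re-derived INSIDE `prod_inv_one_sub_le_exp` below rather than restated. -/

/-! ## §2 The multiplicity count -/

section Count

variable {ε : Type*} [DecidableEq ε]

/-- **MULTIPLICITIES SUM TO A PRODUCT OF GEOMETRIC PARTIAL SUMS**: over `m : E → {0,…,N}`,
`Σ_m ∏_{e} (η e)^{m e} = ∏_{e ∈ E} Σ_{k ≤ N} (η e)^k` (`Finset.prod_univ_sum` on the subtype of `E`). [folklore] -/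
theorem sum_prod_pow_eq (E : Finset ε) (η : ε → ℝ) (N : ℕ) :
    ∑ m ∈ Fintype.piFinset (fun _ : E => range (N + 1)), ∏ e : E, η e ^ m e =
      ∏ e ∈ E, ∑ k ∈ range (N + 1), η e ^ k := by
  rw [← Finset.prod_univ_sum (fun _ : E => range (N + 1)) (fun (e : E) (k : ℕ) => η e ^ k)]
  exact Finset.prod_coe_sort E (fun e => ∑ k ∈ range (N + 1), η e ^ k)

/-- **THE MULTISET OVER-COUNT**: `Σ_m ∏_e (η e)^{m e} ≤ ∏_{e ∈ E} (1 − η e)⁻¹` for `0 ≤ η < 1` on `E`, uniformly in the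
cap `N`. [folklore] -/
theorem sum_prod_pow_le_prod_inv (E : Finset ε) {η : ε → ℝ} (h0 : ∀ e ∈ E, 0 ≤ η e) (h1 : ∀ e ∈ E, η e < 1)
    (N : ℕ) :
    ∑ m ∈ Fintype.piFinset (fun _ : E => range (N + 1)), ∏ e : E, η e ^ m e ≤ ∏ e ∈ E, (1 - η e)⁻¹ := by
  rw [sum_prod_pow_eq]
  exact Finset.prod_le_prod (fun e he => Finset.sum_nonneg fun k _ => pow_nonneg (h0 e he) k)
    fun e he => geom_partial_le_inv (h0 e he) (h1 e he) N

omit [DecidableEq ε] in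
/-- `∏_{e ∈ E} (1 − η e)⁻¹ ≤ e^{2 Σ_{e ∈ E} η e}` for `0 ≤ η ≤ ½` on `E`. [folklore] -/
theorem prod_inv_one_sub_le_exp (E : Finset ε) {η : ε → ℝ} (h0 : ∀ e ∈ E, 0 ≤ η e) (h1 : ∀ e ∈ E, η e ≤ 1 / 2) :
    ∏ e ∈ E, (1 - η e)⁻¹ ≤ Real.exp (2 * ∑ e ∈ E, η e) := by
  rw [Finset.mul_sum, Real.exp_sum]
  refine Finset.prod_le_prod (fun e he => inv_nonneg.2 (by linarith [h1 e he])) fun e he => ?_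
  -- `(1 − x)⁻¹ ≤ e^{2x}` on `[0, ½]`: `e^{2x}(1 − x) ≥ (1 + 2x)(1 − x) ≥ 1`
  have hpos : 0 < 1 - η e := by linarith [h1 e he]
  rw [inv_le_iff_one_le_mul₀ hpos]
  have h2 : 1 + 2 * η e ≤ Real.exp (2 * η e) := by linarith [Real.add_one_le_exp (2 * η e)]
  nlinarith [mul_le_mul_of_nonneg_right h2 hpos.le, h0 e he, h1 e he]

end Count

/-! ## §3 The span condition with multiplicities and the paired record sum -/

section Records

variable {ε : Type*} [DecidableEq ε]

/-- **THE SPAN CONDITION WITH MULTIPLICITIES**: `K + 1 − j ≤ W b + Σ_{e ∈ E} m e · W e`. [folklore] -/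
def SpanLEM (W : ε → ℕ) (j K : ℕ) (b : ε) {E : Finset ε} (m : E → ℕ) : Prop :=
  K + 1 - j ≤ W b + ∑ e : E, m e * W e

/-- the span condition is decidable [folklore] -/
instance SpanLEM.instDecidable (W : ε → ℕ) (j K : ℕ) (b : ε) {E : Finset ε} (m : E → ℕ) :
    Decidable (SpanLEM W j K b m) := by
  unfold SpanLEM; infer_instance

omit [DecidableEq ε] in
/-- a set record is the multiplicity-`≤ 1` record of its indicator, with the same span [folklore] -/
theorem spanLEM_indicator_iff (W : ε → ℕ) (j K : ℕ) (b : ε) {E : Finset ε} (Q : Finset ε) (hQ : Q ⊆ E)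
    [DecidablePred (· ∈ Q)] :
    SpanLEM W j K b (fun e : E => if (e : ε) ∈ Q then 1 else 0) ↔ SpanLE W j K b Q := by
  unfold SpanLEM SpanLE
  have : ∑ e : E, (if (e : ε) ∈ Q then 1 else 0) * W e = ∑ e ∈ Q, W e := by
    rw [Finset.sum_coe_sort E (fun e => (if e ∈ Q then 1 else 0) * W e),
      ← Finset.sum_subset hQ (f := fun e => (if e ∈ Q then 1 else 0) * W e) (fun e _ he => by simp [he])]
    exact Finset.sum_congr rfl fun e he => by simp [he]
  rw [this]

omit [DecidableEq ε] in
/-- **THE PAIRED FACTOR OF ONE MULTISET RECORD**: under the span condition the window parts multiply to at most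
`e^{−κ₁(K + 1 − j)}` (`κ₁ ≥ 0`). [folklore] -/
theorem pairedFactorM_le {W : ε → ℕ} {j K : ℕ} {b : ε} {E : Finset ε} {m : E → ℕ} {κ₁ : ℝ} (hκ : 0 ≤ κ₁)
    (hm : SpanLEM W j K b m) :
    Real.exp (-(κ₁ * W b)) * ∏ e : E, Real.exp (-(κ₁ * W e)) ^ m e ≤
      Real.exp (-(κ₁ * ((K + 1 - j : ℕ) : ℝ))) := by
  have hprod : ∏ e : E, Real.exp (-(κ₁ * W e)) ^ m e = Real.exp (∑ e : E, -(κ₁ * (m e * W e : ℕ))) := by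
    rw [Real.exp_sum]
    refine Finset.prod_congr rfl fun e _ => ?_
    rw [← Real.exp_nat_mul]; congr 1; push_cast; ring
  rw [hprod, ← Real.exp_add]
  apply Real.exp_le_exp.2
  have h : ((K + 1 - j : ℕ) : ℝ) ≤ (W b : ℝ) + ∑ e : E, ((m e * W e : ℕ) : ℝ) := by exact_mod_cast hm
  rw [Finset.sum_neg_distrib, ← Finset.mul_sum]
  nlinarith [mul_le_mul_of_nonneg_left h hκ]

/-- **THE PAIRED RECORD SUM WITH MULTIPLICITIES** (the multiset form of `T4PersistentHistoryCount.pairedRecordSum_le`):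
price hypothesis per multiplicity function `m : E → {0,…,N}` — on span-admissible `m`,
`y m ≤ ρ·e^{−κ₁W b}·∏_e (e^{−κ₁W e}·η e)^{m e}`, and `y m ≤ 0` elsewhere; then
`Σ_m y m ≤ ρ·e^{−κ₁(K+1−j)}·∏_{e ∈ E} (1 − η e)⁻¹` (`0 ≤ η < 1`), UNIFORMLY IN THE CAP `N`. [folklore] -/
theorem pairedRecordSumM_le (W : ε → ℕ) (j K : ℕ) (E : Finset ε) (b : ε) {κ₁ ρ : ℝ} (hκ : 0 ≤ κ₁) (hρ : 0 ≤ ρ)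
    (η : ε → ℝ) (h0 : ∀ e ∈ E, 0 ≤ η e) (h1 : ∀ e ∈ E, η e < 1) (N : ℕ) (y : (E → ℕ) → ℝ)
    (hy : ∀ m ∈ Fintype.piFinset (fun _ : E => range (N + 1)), SpanLEM W j K b m →
      y m ≤ ρ * Real.exp (-(κ₁ * W b)) * ∏ e : E, (Real.exp (-(κ₁ * W e)) * η e) ^ m e)
    (hy0 : ∀ m ∈ Fintype.piFinset (fun _ : E => range (N + 1)), ¬ SpanLEM W j K b m → y m ≤ 0) :
    ∑ m ∈ Fintype.piFinset (fun _ : E => range (N + 1)), y m ≤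
      ρ * Real.exp (-(κ₁ * ((K + 1 - j : ℕ) : ℝ))) * ∏ e ∈ E, (1 - η e)⁻¹ := by
  set c : ℝ := ρ * Real.exp (-(κ₁ * ((K + 1 - j : ℕ) : ℝ))) with hc
  have hc0 : 0 ≤ c := mul_nonneg hρ (Real.exp_pos _).le
  have hstep : ∀ m ∈ Fintype.piFinset (fun _ : E => range (N + 1)), y m ≤ c * ∏ e : E, η e ^ m e := by
    intro m hm
    have hη' : 0 ≤ ∏ e : E, η e ^ m e := Finset.prod_nonneg fun e _ => pow_nonneg (h0 e e.2) _
    by_cases hs : SpanLEM W j K b m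
    · calc y m ≤ ρ * Real.exp (-(κ₁ * W b)) * ∏ e : E, (Real.exp (-(κ₁ * W e)) * η e) ^ m e := hy m hm hs
        _ = ρ * (Real.exp (-(κ₁ * W b)) * ∏ e : E, Real.exp (-(κ₁ * W e)) ^ m e) * ∏ e : E, η e ^ m e := by
            simp only [mul_pow, Finset.prod_mul_distrib]; ring
        _ ≤ c * ∏ e : E, η e ^ m e :=
            mul_le_mul_of_nonneg_right (mul_le_mul_of_nonneg_left (pairedFactorM_le hκ hs) hρ) hη'
    · exact (hy0 m hm hs).trans (mul_nonneg hc0 hη')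
  calc ∑ m ∈ Fintype.piFinset (fun _ : E => range (N + 1)), y m
      ≤ ∑ m ∈ Fintype.piFinset (fun _ : E => range (N + 1)), c * ∏ e : E, η e ^ m e := Finset.sum_le_sum hstep
    _ = c * ∑ m ∈ Fintype.piFinset (fun _ : E => range (N + 1)), ∏ e : E, η e ^ m e := by rw [Finset.mul_sum]
    _ ≤ c * ∏ e ∈ E, (1 - η e)⁻¹ := mul_le_mul_of_nonneg_left (sum_prod_pow_le_prod_inv E h0 h1 N) hc0

end Records

/-! ## §4 The per-step form: the slot price at the doubled rate -/

section PerStep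

variable {ε : Type*} [DecidableEq ε]

omit [DecidableEq ε] in
/-- **PER-STEP RESIDUAL ENTROPY, MULTISET FORM**: if the universe lives on the steps `(j, K]`, the residuals at each step
add up to at most `η̄`, and `η ≤ ½`, then `∏_{e ∈ E} (1 − η e)⁻¹ ≤ e^{2η̄(K − j)}`. [folklore] -/
theorem prod_inv_one_sub_le_exp_mul {E : Finset ε} (step : ε → ℕ) {j K : ℕ}
    (hE : ∀ e ∈ E, step e ∈ Ioc j K) {η : ε → ℝ} {ηbar : ℝ} (h0 : ∀ e ∈ E, 0 ≤ η e)
    (h1 : ∀ e ∈ E, η e ≤ 1 / 2) (hηbar : ∀ t ∈ Ioc j K, ∑ e ∈ E with step e = t, η e ≤ ηbar) :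
    ∏ e ∈ E, (1 - η e)⁻¹ ≤ Real.exp (2 * ηbar * ((K - j : ℕ) : ℝ)) := by
  refine (prod_inv_one_sub_le_exp E h0 h1).trans (Real.exp_le_exp.2 ?_)
  rw [← Finset.sum_fiberwise_of_maps_to (g := step) hE]
  have : ∑ t ∈ Ioc j K, ∑ e ∈ E with step e = t, η e ≤ ηbar * ((K - j : ℕ) : ℝ) := by
    calc ∑ t ∈ Ioc j K, ∑ e ∈ E with step e = t, η e ≤ ∑ _t ∈ Ioc j K, ηbar := Finset.sum_le_sum hηbar
      _ = ηbar * ((K - j : ℕ) : ℝ) := by rw [Finset.sum_const, Nat.card_Ioc, nsmul_eq_mul, mul_comm]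
  nlinarith

/-- **ONE SLOT'S PRICE IN THE TWO-RATE SHAPE, MULTISET FORM** (`T4PersistentHistoryCount.slotPrice_le` at the doubled
rate): under the multiplicity price hypothesis of `pairedRecordSumM_le`, an event universe on the steps `(j, K]` with
per-step residual entropy `≤ η̄` and `η ≤ ½`: `Σ_m y m ≤ ρ·e^{−κ₁}·(e^{2η̄ − κ₁})^{K − j}`. [folklore] -/
theorem slotPriceM_le (W : ε → ℕ) {j K : ℕ} (hjK : j ≤ K) (E : Finset ε) (b : ε)
    (step : ε → ℕ) (hE : ∀ e ∈ E, step e ∈ Ioc j K) {κ₁ ρ ηbar : ℝ} (hκ : 0 ≤ κ₁) (hρ : 0 ≤ ρ)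
    (η : ε → ℝ) (h0 : ∀ e ∈ E, 0 ≤ η e) (h1 : ∀ e ∈ E, η e ≤ 1 / 2)
    (hηbar : ∀ t ∈ Ioc j K, ∑ e ∈ E with step e = t, η e ≤ ηbar) (N : ℕ) (y : (E → ℕ) → ℝ)
    (hy : ∀ m ∈ Fintype.piFinset (fun _ : E => range (N + 1)), SpanLEM W j K b m →
      y m ≤ ρ * Real.exp (-(κ₁ * W b)) * ∏ e : E, (Real.exp (-(κ₁ * W e)) * η e) ^ m e)
    (hy0 : ∀ m ∈ Fintype.piFinset (fun _ : E => range (N + 1)), ¬ SpanLEM W j K b m → y m ≤ 0) :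
    ∑ m ∈ Fintype.piFinset (fun _ : E => range (N + 1)), y m ≤
      ρ * Real.exp (-κ₁) * Real.exp (2 * ηbar - κ₁) ^ (K - j) := by
  have h1' : ∀ e ∈ E, η e < 1 := fun e he => by linarith [h1 e he]
  have hA := pairedRecordSumM_le W j K E b hκ hρ η h0 h1' N y hy hy0
  have hB := prod_inv_one_sub_le_exp_mul step hE h0 h1 hηbar
  have hc0 : 0 ≤ ρ * Real.exp (-(κ₁ * ((K + 1 - j : ℕ) : ℝ))) := mul_nonneg hρ (Real.exp_pos _).le
  calc ∑ m ∈ Fintype.piFinset (fun _ : E => range (N + 1)), y m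
      ≤ ρ * Real.exp (-(κ₁ * ((K + 1 - j : ℕ) : ℝ))) * Real.exp (2 * ηbar * ((K - j : ℕ) : ℝ)) :=
        hA.trans (mul_le_mul_of_nonneg_left hB hc0)
    _ = ρ * Real.exp (-κ₁) * Real.exp (2 * ηbar - κ₁) ^ (K - j) := by
        rw [mul_assoc, exp_span_mul_exp_eq hjK, ← mul_assoc]

end PerStep

/-! ## §5 Sanity, decided ∕ normalised -/

namespace Sanity

/-- the span condition with a multiplicity `2` on a single event type: windows `W ≡ 3`, life `[0, 8]` needs
`9 ≤ 3 + 2·3` — which holds; the SET record `{e}` (multiplicity `1`) fails it (`9 ≤ 6` false). [folklore] -/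
example : SpanLEM (fun _ : ℕ => 3) 0 8 0 (E := {1}) (fun _ => 2) ∧
    ¬ SpanLEM (fun _ : ℕ => 3) 0 8 0 (E := {1}) (fun _ => 1) := by
  decide

/-- the over-count at one event type with `η = ½`, cap `N = 3`: `1 + ½ + ¼ + ⅛ ≤ 2 = (1 − ½)⁻¹`. [folklore] -/
example : ∑ k ∈ range 4, (1 / 2 : ℝ) ^ k ≤ (1 - 1 / 2)⁻¹ := by norm_num [Finset.sum_range_succ]

end Sanity

end

end Summit.QuantumFields.BalabanUV.T4Continuum.MultisetRecords
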